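import Summits.QuantumAdvantage.QuantumAdvantage.Theorems.MobiusLadderDigitPolyUniformityRigidityGlue
import Summits.QuantumAdvantage.QuantumAdvantage.Theorems.MobiusLadderDigitPolyUniformityMRTClasses
import Summits.QuantumAdvantage.QuantumAdvantage.Theorems.MobiusLadderDigitPolyUniformityMRTAlignedWide

/-!
# Crux `DigitPolyUniformity` (stmt-QuantumAdvantage-1392), line `Sketch` — cycle 6 (seat c5), wave 2:
# the two-ends class at EVERY top depth, and W from the WIDE ×p-rigidity hypothesis

`Theorems/…RigidityGlue` (p138143) proved `W ⇐ Rigidity` with, as the correlating tests offered to the rigidity statement,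
the ends functions `g(N mod 2^k, ⌊N/2^{n−m}⌋)` of depths `(k+m)^3 ≤ n` (line 0's `stub_ends`). The canonical near-solutions of
λ's functional equations — `(−1)^{v₂(m)} · sgn cos(2π k log₂ m)` with `k log₂ p ≈ 1/2 (mod 1)` for the odd primes `p ≤ C`
(seat c4 §2) — are functions of a few low digits and of the top `≈ log₂ k` digits, and NOTHING bounds `k`: a rigidity statement
that can only answer with tests of top depth `≤ n^{1/3}` is needlessly strong (possibly false if such chirps with
`log₂ k ≫ n^{1/3}` are of polylog degree). The cycle-5 Matomäki–Radziwiłł–Tao classes supply tests at EVERY top depth: here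

* `liouville_twoEnds_weight_le_wide` (+ `…_real`) — for every `C`, `ε` there is `h₀` with, eventually in `n`, for ALL depths
  `h₀ ≤ h ≤ n − h₀` and every 1-bounded `g`: `|Σ_{N<2ⁿ} λ(N) g(N mod 2^C, ⌊N/2^h⌋)| ≤ ε2ⁿ` (from `stub_alignedMRT_wide`,
  `Theorems/…MRTAlignedWide`, exactly as `liouville_twoEnds_weight_le` from `stub_alignedMRT`);
* `inapprox_range_of_rigidity_wide`, `liouvilleNotAC0Xor_of_rigidity_wide` — W, and `L_λ ∉ AC0Mod 2`, from the WIDE rigidity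
  hypothesis, whose conclusion may use any test `g(N mod 2^{C'}, ⌊N/2^h⌋)`, `h₀ ≤ h ≤ n − h₀`, for the `h₀` prescribed by the
  λ-side (`∀ A h₀, ∀ᶠ n, …`):

  RigidityWide := `∃ C C' η ρ, 0<η ∧ 0<ρ ∧ ∀ A h₀, ∀ᶠ n, ∀ P, deg P ≤ (log₂ n)^A →
     (∀ p prime ≤ C, #{1 ≤ m < 2ⁿ/p : χ_P(pm) = χ_P(m)} ≤ η2ⁿ) →
     ∃ h, h₀ ≤ h ∧ h + h₀ ≤ n ∧ ∃ g 1-bounded, ρ2ⁿ ≤ |Σ_{N<2ⁿ} χ_P(N) g(N mod 2^{C'}, ⌊N/2^h⌋)|`.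

  This is implied by the narrow form for tests of top depth in `[h₀, n^{1/3}]` and is the form in which all known
  near-solutions (shell characters, Benford chirps of ANY frequency `k ≤ 2^{n−h₀}`) are themselves admissible tests, so
  that only genuinely new (non-ends) near-solutions could refute it. It is a CONJECTURE of this line, never asserted.

The λ-inputs are `λ(pm) = −λ(m)`, `λ ∈ {0, ±1}`, and the PROVED two-ends class (Matomäki–Radziwiłł–Tao 2015 Thm 1.3, in the tree).
-/

noncomputable section

namespace Summit.QuantumAdvantage.DigitPolyUniformity.SketchLAR

open Filter Finset
open Literature.NumberTheory.LFunctions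
open RigidityGlue

/-- **Two-ends weights at every top depth (complex form).** For every `C` and `ε > 0` there is `h₀` such that,
eventually in `n`, for every depth `h₀ ≤ h ≤ n − h₀` and every `1`-bounded `g : ℕ → ℕ → ℂ`,
`‖Σ_{N<2ⁿ} λ(N) g(N mod 2^C, ⌊N/2^h⌋)‖ ≤ ε 2ⁿ`. As `liouville_twoEnds_weight_le` (`Theorems/…MRTClasses`) with
`stub_alignedMRT_wide` in place of `stub_alignedMRT`. [cite: MatomakiRadziwillTao2015, Theorem 1.3] -/
theorem liouville_twoEnds_weight_le_wide :
    ∀ C : ℕ, ∀ ε : ℝ, 0 < ε → ∃ h₀ : ℕ, ∀ᶠ n : ℕ in atTop, ∀ h : ℕ, h₀ ≤ h → h + h₀ ≤ n →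
      ∀ g : ℕ → ℕ → ℂ, (∀ r y, ‖g r y‖ ≤ 1) →
        ‖∑ N ∈ range (2 ^ n), ((ArithmeticFunction.liouville N : ℤ) : ℂ) * g (N % 2 ^ C) (N / 2 ^ h)‖ ≤
          ε * 2 ^ n := by
  intro C ε hε
  obtain ⟨h₀, hh₀⟩ := stub_alignedMRT_wide (ε / 2 ^ C) (by positivity)
  refine ⟨h₀, ?_⟩
  filter_upwards [hh₀] with n hn h hh0h hhn g hg
  have hF : ∀ y : ℕ, ∃ c : ℕ → ℂ, (∀ a, ‖c a‖ ≤ 1) ∧ ∀ N : ℕ, g (N % 2 ^ C) y =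
      ∑ a ∈ range (2 ^ C), c a * VdC.e ((a : ℝ) * N / 2 ^ C) :=
    fun y => stub_fourier_lowDigits C (fun r => g r y) (fun r => hg r y)
  choose c hc1 hc2 using hF
  have hsum : ∑ N ∈ range (2 ^ n), ((ArithmeticFunction.liouville N : ℤ) : ℂ) * g (N % 2 ^ C) (N / 2 ^ h) =
      ∑ a ∈ range (2 ^ C), ∑ N ∈ range (2 ^ n),
        (((ArithmeticFunction.liouville N : ℤ) : ℂ) * VdC.e ((a : ℝ) / 2 ^ C * N)) * c (N / 2 ^ h) a := by
    rw [Finset.sum_comm]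
    refine Finset.sum_congr rfl fun N _ => ?_
    rw [hc2 (N / 2 ^ h) N, Finset.mul_sum]
    refine Finset.sum_congr rfl fun a _ => ?_
    rw [div_mul_eq_mul_div]
    ring
  rw [hsum]
  refine (norm_sum_le _ _).trans ?_
  have hn' : h + (n - h) = n := by omega
  have key : ∀ a ∈ range (2 ^ C), ‖∑ N ∈ range (2 ^ n),
      (((ArithmeticFunction.liouville N : ℤ) : ℂ) * VdC.e ((a : ℝ) / 2 ^ C * N)) * c (N / 2 ^ h) a‖ ≤
      ε / 2 ^ C * 2 ^ n := by
    intro a _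
    have hreg := stub_regroup_blocks
      (fun N : ℕ => ((ArithmeticFunction.liouville N : ℤ) : ℂ) * VdC.e ((a : ℝ) / 2 ^ C * N))
      (fun y => c y a) (fun y => hc1 y a) h (n - h)
    rw [hn'] at hreg
    refine hreg.trans ?_
    exact hn h hh0h hhn ((a : ℝ) / 2 ^ C)
  calc ∑ a ∈ range (2 ^ C), ‖∑ N ∈ range (2 ^ n),
        (((ArithmeticFunction.liouville N : ℤ) : ℂ) * VdC.e ((a : ℝ) / 2 ^ C * N)) * c (N / 2 ^ h) a‖
      ≤ ∑ a ∈ range (2 ^ C), ε / 2 ^ C * 2 ^ n := Finset.sum_le_sum key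
    _ = ε * 2 ^ n := by
      rw [Finset.sum_const, Finset.card_range, nsmul_eq_mul]
      push_cast
      field_simp

/-- **Two-ends weights at every top depth (real form).** [cite: MatomakiRadziwillTao2015, Theorem 1.3] -/
theorem liouville_twoEnds_weight_le_wide_real :
    ∀ C : ℕ, ∀ ε : ℝ, 0 < ε → ∃ h₀ : ℕ, ∀ᶠ n : ℕ in atTop, ∀ h : ℕ, h₀ ≤ h → h + h₀ ≤ n →
      ∀ g : ℕ → ℕ → ℝ, (∀ r y, |g r y| ≤ 1) →
        |∑ N ∈ range (2 ^ n), (ArithmeticFunction.liouville N : ℝ) * g (N % 2 ^ C) (N / 2 ^ h)| ≤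
          ε * 2 ^ n := by
  intro C ε hε
  obtain ⟨h₀, hh₀⟩ := liouville_twoEnds_weight_le_wide C ε hε
  refine ⟨h₀, ?_⟩
  filter_upwards [hh₀] with n hn h hh0h hhn g hg
  have hg' : ∀ r y, ‖((g r y : ℝ) : ℂ)‖ ≤ 1 := fun r y => by
    rw [Complex.norm_real, Real.norm_eq_abs]; exact hg r y
  have := hn h hh0h hhn (fun r y => (g r y : ℂ)) hg'
  have hcast : ((∑ N ∈ range (2 ^ n), (ArithmeticFunction.liouville N : ℝ) * g (N % 2 ^ C) (N / 2 ^ h) : ℝ) : ℂ)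
      = ∑ N ∈ range (2 ^ n), ((ArithmeticFunction.liouville N : ℤ) : ℂ) * (g (N % 2 ^ C) (N / 2 ^ h) : ℂ) := by
    push_cast; rfl
  rw [← Real.norm_eq_abs, ← Complex.norm_real, hcast]
  exact this

/-- **The weak target W from WIDE ×p-rigidity.** If polylog-degree digital phases with small ×p-defects for all primes
`p ≤ C` correlate with SOME two-ends test `g(N mod 2^{C'}, ⌊N/2^h⌋)` at a depth `h₀ ≤ h ≤ n − h₀` of the λ-side's choosing
(hypothesis `hR`, the WIDE rigidity conjecture of this line — λ-free, never asserted), then for some `c > 0`, for every `A`,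
eventually no `P` of degree `≤ (log₂ n)^A` has `Σ_{N<2ⁿ} λ χ_P > (1 − c)2ⁿ`. Proof as `inapprox_range_of_rigidity`, with the
two-ends class `liouville_twoEnds_weight_le_wide_real` (Matomäki–Radziwiłł–Tao) in place of `stub_ends`.
[cite: MatomakiRadziwillTao2015, Theorem 1.3] -/
theorem inapprox_range_of_rigidity_wide
    (hR : ∃ C C' : ℕ, ∃ η ρ : ℝ, 0 < η ∧ 0 < ρ ∧ ∀ A h₀ : ℕ, ∀ᶠ n : ℕ in atTop,
      ∀ P : MvPolynomial (Fin n) (ZMod 2), P.totalDegree ≤ Nat.log 2 n ^ A →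
        (∀ p : ℕ, p.Prime → p ≤ C →
          ((((Ico 1 (2 ^ n / p)).filter fun m =>
              (if MvPolynomial.eval (fun i : Fin n => if Nat.testBit (p * m) i then (1 : ZMod 2) else 0) P = 1
                then (-1 : ℝ) else 1) =
              (if MvPolynomial.eval (fun i : Fin n => if Nat.testBit m i then (1 : ZMod 2) else 0) P = 1
                then (-1 : ℝ) else 1)).card : ℕ) : ℝ) ≤ η * 2 ^ n) →
        ∃ h : ℕ, h₀ ≤ h ∧ h + h₀ ≤ n ∧ ∃ g : ℕ → ℕ → ℝ, (∀ a b, |g a b| ≤ 1) ∧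
          ρ * 2 ^ n ≤ |∑ N ∈ range (2 ^ n),
            (if MvPolynomial.eval (fun i : Fin n => if Nat.testBit N i then (1 : ZMod 2) else 0) P = 1
              then (-1 : ℝ) else 1) * g (N % 2 ^ C') (N / 2 ^ h)|) :
    ∃ c : ℝ, 0 < c ∧ ∀ A : ℕ, ∀ᶠ n : ℕ in atTop, ∀ P : MvPolynomial (Fin n) (ZMod 2),
        P.totalDegree ≤ Nat.log 2 n ^ A →
          ∑ N ∈ Finset.range (2 ^ n), ((ArithmeticFunction.liouville N : ℤ) : ℝ) *
              (if MvPolynomial.eval (fun i : Fin n => if Nat.testBit N i then (1 : ZMod 2) else 0) P = 1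
                then (-1 : ℝ) else 1) ≤ (1 - c) * (2 : ℝ) ^ n := by
  obtain ⟨C, C', η, ρ, hη, hρ, hR⟩ := hR
  refine ⟨min η (ρ / 4), lt_min hη (by positivity), fun A => ?_⟩
  obtain ⟨h₀, hends⟩ := liouville_twoEnds_weight_le_wide_real C' (ρ / 4) (by positivity)
  have hbig : ∀ᶠ n : ℕ in atTop, 2 / ρ ≤ (2 : ℝ) ^ n := by
    refine (Filter.eventually_ge_atTop ⌈2 / ρ⌉₊).mono fun n hn => ?_
    have h1 : (2 / ρ : ℝ) ≤ n := (Nat.le_ceil _).trans (by exact_mod_cast hn)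
    have h2 : (n : ℝ) ≤ (2 : ℝ) ^ n := by exact_mod_cast Nat.lt_two_pow_self.le
    linarith
  filter_upwards [hR A h₀, hends, hbig] with n hRn hEn hbn P hP
  set φ : ℕ → ℝ := fun N =>
    (if MvPolynomial.eval (fun i : Fin n => if Nat.testBit N i then (1 : ZMod 2) else 0) P = 1
      then (-1 : ℝ) else 1) with hφdef
  set lam : ℕ → ℝ := fun N => ((ArithmeticFunction.liouville N : ℤ) : ℝ) with hlamdef
  have hφ : ∀ N, φ N = 1 ∨ φ N = -1 := fun N => by
    simp only [hφdef]; split_ifs <;> simp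
  have hlam0 : lam 0 = 0 := by simp [hlamdef]
  have hlam : ∀ N ∈ Ico 1 (2 ^ n), lam N = 1 ∨ lam N = -1 := fun N hN =>
    liouville_real_eq_or (by have := (Finset.mem_Ico.1 hN).1; omega)
  have hX : 1 ≤ 2 ^ n := Nat.one_le_two_pow
  show ∑ N ∈ range (2 ^ n), lam N * φ N ≤ (1 - min η (ρ / 4)) * 2 ^ n
  by_contra hcon
  rw [not_le] at hcon
  set E : Finset ℕ := (Ico 1 (2 ^ n)).filter fun N => φ N ≠ lam N with hEdef
  have hcount := sum_eq_card hX hlam0 hlam hφ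
  rw [hcount] at hcon
  have hc1 : min η (ρ / 4) ≤ η := min_le_left _ _
  have hc2 : min η (ρ / 4) ≤ ρ / 4 := min_le_right _ _
  have h2n : (0 : ℝ) < 2 ^ n := by positivity
  have hE : 2 * (E.card : ℝ) < min η (ρ / 4) * 2 ^ n := by
    rw [hEdef]; push_cast at hcon; linarith
  have hdef : ∀ p : ℕ, p.Prime → p ≤ C →
      ((((Ico 1 (2 ^ n / p)).filter fun m => φ (p * m) = φ m).card : ℕ) : ℝ) ≤ η * 2 ^ n := by
    intro p hp _
    have hle := defect_le (M := 2 ^ n / p) hp.ne_zero φ E (fun m hm hmE hpmE => ?_)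
    · have : (((Ico 1 (2 ^ n / p)).filter fun m => φ (p * m) = φ m).card : ℝ) ≤ 2 * E.card := by
        exact_mod_cast hle
      nlinarith
    · have hm1 : 1 ≤ m := (Finset.mem_Ico.1 hm).1
      have hmM : m < 2 ^ n / p := (Finset.mem_Ico.1 hm).2
      have hpm : p * m < 2 ^ n := by
        have := Nat.div_mul_le_self (2 ^ n) p
        have h' : p * m < p * (2 ^ n / p) := Nat.mul_lt_mul_of_pos_left hmM hp.pos
        rw [mul_comm p (2 ^ n / p)] at h'
        omega
      have hmle : m ≤ p * m := Nat.le_mul_of_pos_left m hp.pos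
      have hmI : m ∈ Ico 1 (2 ^ n) := Finset.mem_Ico.2 ⟨hm1, by omega⟩
      have hpmI : p * m ∈ Ico 1 (2 ^ n) := Finset.mem_Ico.2 ⟨by omega, hpm⟩
      have hφm : φ m = lam m := by
        by_contra hne; exact hmE (Finset.mem_filter.2 ⟨hmI, hne⟩)
      have hφpm : φ (p * m) = lam (p * m) := by
        by_contra hne; exact hpmE (Finset.mem_filter.2 ⟨hpmI, hne⟩)
      have hlampm : lam (p * m) = -lam m := by
        simp only [hlamdef]
        rw [liouville_prime_mul hp (by omega)]
        push_cast; ring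
      rw [hφpm, hφm, hlampm]
      rcases hlam m hmI with h | h <;> rw [h] <;> norm_num
  obtain ⟨h, hh0h, hhn, g, hg, hcorr⟩ := hRn P hP hdef
  have hends' := hEn h hh0h hhn g hg
  have htrans := corr_transfer hX hlam0 hlam hφ (G := fun N => g (N % 2 ^ C') (N / 2 ^ h))
    (fun N => hg _ _)
  have hρ2 : ρ * 2 ^ n < ρ / 2 * 2 ^ n + 1 := by
    calc ρ * 2 ^ n ≤ |∑ N ∈ range (2 ^ n), φ N * g (N % 2 ^ C') (N / 2 ^ h)| := hcorr
      _ ≤ |∑ N ∈ range (2 ^ n), lam N * g (N % 2 ^ C') (N / 2 ^ h)| + 1 + 2 * (E.card : ℝ) := htrans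
      _ < ρ / 4 * 2 ^ n + 1 + ρ / 4 * 2 ^ n := by nlinarith [hends']
      _ = ρ / 2 * 2 ^ n + 1 := by ring
  have : ρ / 2 * 2 ^ n < 1 := by linarith
  rw [div_le_iff₀ hρ] at hbn
  nlinarith

/-- **The `AC⁰[⊕]` rung from WIDE ×p-rigidity** — composition with the landed weak glue (p135858).
[cite: Razborov1987] [cite: Smolensky1987] -/
theorem liouvilleNotAC0Xor_of_rigidity_wide
    (hR : ∃ C C' : ℕ, ∃ η ρ : ℝ, 0 < η ∧ 0 < ρ ∧ ∀ A h₀ : ℕ, ∀ᶠ n : ℕ in atTop,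
      ∀ P : MvPolynomial (Fin n) (ZMod 2), P.totalDegree ≤ Nat.log 2 n ^ A →
        (∀ p : ℕ, p.Prime → p ≤ C →
          ((((Ico 1 (2 ^ n / p)).filter fun m =>
              (if MvPolynomial.eval (fun i : Fin n => if Nat.testBit (p * m) i then (1 : ZMod 2) else 0) P = 1
                then (-1 : ℝ) else 1) =
              (if MvPolynomial.eval (fun i : Fin n => if Nat.testBit m i then (1 : ZMod 2) else 0) P = 1
                then (-1 : ℝ) else 1)).card : ℕ) : ℝ) ≤ η * 2 ^ n) →
        ∃ h : ℕ, h₀ ≤ h ∧ h + h₀ ≤ n ∧ ∃ g : ℕ → ℕ → ℝ, (∀ a b, |g a b| ≤ 1) ∧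
          ρ * 2 ^ n ≤ |∑ N ∈ range (2 ^ n),
            (if MvPolynomial.eval (fun i : Fin n => if Nat.testBit N i then (1 : ZMod 2) else 0) P = 1
              then (-1 : ℝ) else 1) * g (N % 2 ^ C') (N / 2 ^ h)|) :
    Computability.encodingNatBool.toLanguage {N : ℕ | ArithmeticFunction.liouville N = -1} ∉
      Literature.Computability.Complexity.AC0Mod 2 :=
  liouvilleNotAC0Xor_of_inapprox_range (inapprox_range_of_rigidity_wide hR)

end Summit.QuantumAdvantage.DigitPolyUniformity.SketchLAR

end
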